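import Mathlib
import Summits.ValiantsHypothesis.ValiantsHypothesis.Theorems.RigidityForcesSymmetryRankRigidMinimalReprLaplaceDual
import Summits.ValiantsHypothesis.ValiantsHypothesis.Theorems.RigidityForcesSymmetryRankRigidMinimalReprLaplaceTriangularBasis

/-!
# `LaplaceOptimalFive`, slice classes `a = 4`, the two basis-row configurations
# (crux `RankRigidMinimalRepr`, stmt-ValiantsHypothesis-18034; frontier rung `LaplaceOptimalFive`, stmt-24813)

Companion of `…LaplaceFiveFourSlices.lean` (`four_slices_one_pair`: four slices + one pair term never represent `P₅`
when the slots admit a triangular order — 14 of the 16 `a = 4` configurations).  The remaining two configurations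
(«one slice at each of four slots, pair through the fifth slot» and «slices 2+1+1 at three slots, pair on the other
two») have no slice-free slot outside the pair cut; `four_slices_one_pair_basis` handles them with the BASIS-ROW order
of `LaplaceTriangular.triangular_witness_basis`: the first slot of the order is slice-free and not the later pair
endpoint, its covector is `e_{c₀}`, and ONE later slot earns a bonus because one of its slice vectors `α_k` has
`α_k(c₀) ≠ 0` (choose `c₀` in the support of `α_k`; if `α_k = 0` the configuration has fewer slices and
`four_slices_one_pair` applies).  E.g. slices at slots `0,1,2,3`, pair `{0,4}`: order `(4,0,2,3,1)`, `c₀ ∈ supp α₁`;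
slices `0,0,1,2`, pair `{3,4}`: order `(4,0,3,2,1)`, `c₀ ∈ supp α₁` — the count hypothesis below then holds by `decide`.

HONEST FRAMING: an exact partial result toward the frontier rung `LaplaceOptimalFive` (stmt-24813), which stays OPEN;
with `four_slices_one_pair` it covers every cheap profile with `≥ 4` slices (assembly = a finite case analysis, not in
this file); nothing here bears on `VP ≠ VNP`.
-/

set_option autoImplicit false

-- the mandated summit-side namespace repeats a component by design (single-problem summit)
set_option linter.dupNamespace false

namespace Summit.ValiantsHypothesis.ValiantsHypothesis.Theorems.RigidityForcesSymmetryRankRigidMinimalRepr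

namespace LaplaceFiveSlices

open Finset

/-- **Four slices + one pair term ≠ P₅ (basis-row configurations).**  As `four_slices_one_pair`, for an order
`ord` whose first slot carries no slice and is not the later pair endpoint, a column `c₀`, and the basis-row count
condition: at each position `j ≥ 1`, `#{slices at ord j} + [ord j = q] + j ≤ 4`, or `≤ 5` if some slice vector
`α_k` at that slot has `α_k(c₀) ≠ 0`. -/
theorem four_slices_one_pair_basis (i : Fin 4 → Fin 5) (α : Fin 4 → Fin 5 → ℂ) (W : Fin 4 → (Fin 5 → Fin 5) → ℂ)
    (hW : ∀ k, ∀ v v' : Fin 5 → Fin 5, (∀ j, j ≠ i k → v j = v' j) → W k v = W k v')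
    (p q : Fin 5) (u w : (Fin 5 → Fin 5) → ℂ)
    (hu : ∀ v v' : Fin 5 → Fin 5, v p = v' p → v q = v' q → u v = u v')
    (hw : ∀ v v' : Fin 5 → Fin 5, (∀ j, j ≠ p → j ≠ q → v j = v' j) → w v = w v')
    (ord : Equiv.Perm (Fin 5)) (hpq : ord.symm p < ord.symm q) (c₀ : Fin 5)
    (h0 : ∀ k, i k ≠ ord 0)
    (hcount : ∀ j : Fin 5, 0 < (j : ℕ) →
      (univ.filter (fun k : Fin 4 => i k = ord j)).card + (if ord j = q then 1 else 0) + (j : ℕ) + 1 ≤ 5 ∨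
      ((univ.filter (fun k : Fin 4 => i k = ord j)).card + (if ord j = q then 1 else 0) + (j : ℕ) ≤ 5 ∧
        ∃ k, i k = ord j ∧ α k c₀ ≠ 0)) :
    ¬ ∀ v : Fin 5 → Fin 5,
      (if Function.Injective v then (1 : ℂ) else 0) = (∑ k, α k (v (i k)) * W k v) + u v * w v := by
  classical
  intro H
  have hpq' : p ≠ q := fun h => by rw [h] at hpq; exact lt_irrefl _ hpq
  -- the witness
  let A : Fin 5 → Finset (Fin 5 → ℂ) := fun s => (univ.filter (fun k : Fin 4 => i k = s)).image α
  let g : Fin 5 → Fin 5 → ℂ := fun a b => u (Function.update (Function.update (fun _ => (0 : Fin 5)) p a) q b)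
  have hA0 : A (ord ⟨0, by norm_num⟩) = ∅ := by
    simp only [A, image_eq_empty, filter_eq_empty_iff]
    intro k _ hk
    exact h0 k (by simpa using hk)
  have hcount' : ∀ j : Fin 5, 0 < (j : ℕ) →
      (A (ord j)).card + (if ord j = q then 1 else 0) + (j : ℕ) + 1 ≤ 5 ∨
      ((A (ord j)).card + (if ord j = q then 1 else 0) + (j : ℕ) ≤ 5 ∧ ∃ β ∈ A (ord j), β c₀ ≠ 0) := by
    intro j hj
    have h1 : (A (ord j)).card ≤ (univ.filter (fun k : Fin 4 => i k = ord j)).card := card_image_le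
    rcases hcount j hj with h2 | ⟨h2, k, hk, hkc⟩
    · left; omega
    · right
      refine ⟨by omega, α k, ?_, hkc⟩
      simp only [A, mem_image, mem_filter, mem_univ, true_and]
      exact ⟨k, hk, rfl⟩
  obtain ⟨φ, hφA, hφg, hper⟩ :=
    LaplaceTriangular.triangular_witness_basis (by norm_num) ord A p q hpq g c₀ hA0 hcount'
  -- the decomposition in the data format of `LaplaceOptimal 5`: terms `Fin 5` = four slices, then the pair
  let S : Fin 5 → Finset (Fin 5) := Fin.snoc (fun k : Fin 4 => ({i k} : Finset (Fin 5))) {p, q}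
  let U : Fin 5 → (Fin 5 → Fin 5) → ℂ := Fin.snoc (fun (k : Fin 4) (v : Fin 5 → Fin 5) => α k (v (i k))) u
  let V : Fin 5 → (Fin 5 → Fin 5) → ℂ := Fin.snoc W w
  have hS1 : ∀ k : Fin 4, S k.castSucc = {i k} := fun k => by simp [S]
  have hS2 : S (Fin.last 4) = {p, q} := Fin.snoc_last _ _
  have hU1 : ∀ k : Fin 4, U k.castSucc = fun v => α k (v (i k)) := fun k => by simp [U]
  have hU2 : U (Fin.last 4) = u := Fin.snoc_last _ _
  have hV1 : ∀ k : Fin 4, V k.castSucc = W k := fun k => by simp [V]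
  have hV2 : V (Fin.last 4) = w := Fin.snoc_last _ _
  refine LaplaceDual.no_decomposition_of_witness (d := 5) (univ : Finset (Fin 5)) S U V ?_ ?_ 0 φ hper ?_ ?_
  · -- `U t` sees only the slots of `S t`
    intro t v v' hvv'
    rcases Fin.eq_castSucc_or_eq_last t with ⟨k, rfl⟩ | rfl
    · rw [hU1]
      have := hvv' (i k) (by rw [hS1]; simp)
      simp [this]
    · rw [hU2]
      exact hu v v' (hvv' p (by rw [hS2]; simp)) (hvv' q (by rw [hS2]; simp))
  · -- `V t` is blind to the slots of `S t`
    intro t v v' hvv'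
    rcases Fin.eq_castSucc_or_eq_last t with ⟨k, rfl⟩ | rfl
    · rw [hV1]
      exact hW k v v' (fun j hj => hvv' j (by rw [hS1]; simpa using hj))
    · rw [hV2]
      exact hw v v' (fun j hjp hjq => hvv' j (by rw [hS2]; simp [hjp, hjq]))
  · -- every term is killed by `φ`
    intro t _
    rcases Fin.eq_castSucc_or_eq_last t with ⟨k, rfl⟩ | rfl
    · left
      rw [hS1, hU1]
      refine LaplaceDual.kill_slice (d := 5) 0 (i k) φ (fun v => α k (v (i k))) ?_
      have := hφA (i k) (α k) (by simp only [A, mem_image, mem_filter, mem_univ, true_and]; exact ⟨k, rfl, rfl⟩)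
      simpa [Function.update_self] using this
    · left
      rw [hS2, hU2]
      exact LaplaceDual.kill_pair (d := 5) 0 p q hpq' φ u hφg
  · -- the purported identity
    intro v
    rw [Fin.sum_univ_castSucc]
    simp only [hU1, hU2, hV1, hV2]
    exact (H v).symm

end LaplaceFiveSlices

end Summit.ValiantsHypothesis.ValiantsHypothesis.Theorems.RigidityForcesSymmetryRankRigidMinimalRepr
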